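import Mathlib
import HarnessLib
import Literature.Probability.Percolation.Percolation
import Literature.Probability.Percolation.PercolationProofs
import Literature.Probability.Percolation.BondPercolationSymmetry
import Literature.Probability.Percolation.SiteConnectionTools
import Literature.Probability.Percolation.StoppingSetDecoupling
import Literature.Probability.LatticeModels.LatticeGraph
import Literature.Probability.LatticeModels.ThermodynamicLimit
import Summits.CriticalPhenomena.PercolationContinuityZ3.Theorems.PercTreeValueTetrahedronLogConvexityCertDefs
import Summits.CriticalPhenomena.PercolationContinuityZ3.Theorems.PercTreeValueTetrahedronLogConvexityReflection
import Summits.CriticalPhenomena.PercolationContinuityZ3.Theorems.PercTreeValueTetrahedronLogConvexityStopping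
import Summits.CriticalPhenomena.PercolationContinuityZ3.Theorems.PercTreeValueTetrahedronLogConvexityStrongMarkov
import Summits.CriticalPhenomena.PercolationContinuityZ3.Theorems.PercTreeValueTetrahedronLogConvexityMirrorCSPart1

/-!
# Mirror Cauchy–Schwarz for the two-seed certificate (support stub `stub_mirrorCS`, part 2)

Crux `TetrahedronLogConvexity` (stmt-CriticalPhenomena-7801), line `Sketch` (certificate form);
objects of `PercTreeValueTetrahedronLogConvexityCertDefs.lean` (`Pc`, `AR`, `hyb`, `Qb`, `Qbc`,
`Qbb`, the tetrahedron vertices `vA vB vC`).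

Main result `stub_mirrorCS`: `2·Qb² ≤ P(A_R)·(Qbc + Qbb)` — the free (`v = 0`) part of the
vigour inequality of the certificate line. Proof:
* **data decomposition** (`…StrongMarkov.lean`, valid by the stopping property
  `…Stopping.lean`): with `w_d = P(piece_d ∩ A_R)`, `β_d = P(cont_d ∈ {0 ↔ b_r})`,
  `γ_d = P(cont_d ∈ {0 ↔ c_r})` one has `Qb = Σ w β`, `Qbc = Σ w βγ`, `Qbb = Σ w β²`,
  `P(A_R) = Σ w`, and also `P(A_R ∩ {0 ↔ b_r}) = Σ w β`, `P(A_R ∩ {0 ↔ c_r}) = Σ w γ`,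
  `Qcc = Σ w γ²`;
* **mirror symmetry** (part 1, `…MirrorCSPart1.lean`, and `…Reflection.lean`): the coordinate
  swap `θ = (x₀ x₁)` fixes `0, a_r`, swaps `b_r ↔ c_r`, leaves `A_R` invariant and commutes with
  the hybrid, and `P_{p_c}`, `P ⊗ P ⊗ P` are `θ`-invariant (`bondPercolation_map_relabel_iso`,
  `Measure.map_prod_map`); hence `P(A_R ∩ {0 ↔ c_r}) = P(A_R ∩ {0 ↔ b_r})` and `Qcc = Qbb`, i.e.
  `Σ w γ = Σ w β` and `Σ w γ² = Σ w β²`;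
* **Cauchy–Schwarz** with the weights `w ≥ 0` and `q = β + γ`:
  `(Σ w q)² ≤ (Σ w)(Σ w q²)`, i.e. `4 Qb² ≤ P(A_R) · 2(Qbc + Qbb)`
  (`Finset.sum_sq_le_sum_mul_sum_of_sq_le_mul`).
-/

noncomputable section

open MeasureTheory
open Literature.Probability.Percolation Literature.Probability.LatticeModels

namespace Summit.CriticalPhenomena.PercolationContinuityZ3.Theorems.TetrahedronLogConvexity.Cert

/-! ### The mirror `θ = (x₀ x₁)` on the tetrahedron and on events -/

/-- The swap `θ` maps `b_r = (r, 0, r)` to `c_r = (0, r, r)`. [folklore] -/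
theorem mirror_swap_vB (r : ℕ) :
    (zdSignedPermIso (Equiv.swap (0 : Fin 3) 1) (fun _ => 1)).toEquiv (vB r) = vC r := by
  unfold vB vC
  rw [reflection_swap_apply]
  funext i
  fin_cases i <;> rfl

/-- The swap `θ` preserves the boxes `Λ(n)`. [folklore] -/
theorem mirror_swap_mem_box_iff (n : ℕ) (x : Site 3) :
    (zdSignedPermIso (Equiv.swap (0 : Fin 3) 1) (fun _ => 1)).toEquiv x ∈ box 3 n ↔ x ∈ box 3 n :=
  signedPerm_mem_box_iff _ _

/-- `θ '' ζ ∈ {0 ↔ b_r} ↔ ζ ∈ {0 ↔ c_r}`. [folklore] -/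
theorem mirror_swap_mem_openConn_vB (r : ℕ) (ζ : BondConfig (Site 3)) :
    BondConfig.relabel (sym2Equiv (zdSignedPermIso (Equiv.swap (0 : Fin 3) 1) (fun _ => 1)).toEquiv) ζ ∈
        openConn 0 (vB r) ↔ ζ ∈ openConn 0 (vC r) := by
  have h := mirror_relabel_mem_openConn_iff
    (zdSignedPermIso (Equiv.swap (0 : Fin 3) 1) (fun _ => 1)).toEquiv ζ 0 (vC r)
  have hC : (zdSignedPermIso (Equiv.swap (0 : Fin 3) 1) (fun _ => 1)).toEquiv (vC r) = vB r :=
    reflection_swap_vC r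
  rwa [reflection_swap_zero, hC] at h

/-- `θ '' ζ ∈ {0 ↔ c_r} ↔ ζ ∈ {0 ↔ b_r}`. [folklore] -/
theorem mirror_swap_mem_openConn_vC (r : ℕ) (ζ : BondConfig (Site 3)) :
    BondConfig.relabel (sym2Equiv (zdSignedPermIso (Equiv.swap (0 : Fin 3) 1) (fun _ => 1)).toEquiv) ζ ∈
        openConn 0 (vC r) ↔ ζ ∈ openConn 0 (vB r) := by
  have h := mirror_relabel_mem_openConn_iff
    (zdSignedPermIso (Equiv.swap (0 : Fin 3) 1) (fun _ => 1)).toEquiv ζ 0 (vB r)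
  rwa [reflection_swap_zero, mirror_swap_vB] at h

/-- `a_r` is fixed by the swap (restated for `vA`). [folklore] -/
theorem mirror_swap_vA (r : ℕ) :
    (zdSignedPermIso (Equiv.swap (0 : Fin 3) 1) (fun _ => 1)).toEquiv (vA r) = vA r :=
  reflection_swap_vA r

/-! ### Measure-level mirror symmetry -/

/-- **One continuation**: `P(A_R ∩ {0 ↔ c_r}) = P(A_R ∩ {0 ↔ b_r})` (`A_R` is `θ`-invariant,
`θ` swaps the two targets, `P_{p_c}` is `θ`-invariant). [folklore] -/
theorem mirror_real_AR_inter_openConn (r R : ℕ) :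
    Pc.real (AR r R ∩ openConn 0 (vC r)) = Pc.real (AR r R ∩ openConn 0 (vB r)) := by
  have hpre : BondConfig.relabel
        (sym2Equiv (zdSignedPermIso (Equiv.swap (0 : Fin 3) 1) (fun _ => 1)).toEquiv) ⁻¹'
      (AR r R ∩ openConn 0 (vB r)) = AR r R ∩ openConn 0 (vC r) := by
    ext ω
    simp only [Set.mem_preimage, Set.mem_inter_iff]
    exact and_congr (mirror_mem_AR_relabel _ reflection_swap_zero (mirror_swap_vA r) R ω)
      (mirror_swap_mem_openConn_vB r ω)
  rw [← hpre]
  exact bondPercolation_real_preimage_relabel_iso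
    (zdSignedPermIso (Equiv.swap (0 : Fin 3) 1) (fun _ => 1)) (criticalProbI 3) _

/-- The triple product `P ⊗ P ⊗ P` is invariant under the diagonal action of a lattice
automorphism (`bondPercolation_map_relabel_iso` and `Measure.map_prod_map`). [folklore] -/
theorem mirror_map_prod₃ (φ : zdGraph 3 ≃g zdGraph 3) :
    (Pc.prod (Pc.prod Pc)).map (MeasurableEquiv.prodCongr (BondConfig.relabel (sym2Equiv φ.toEquiv))
      (MeasurableEquiv.prodCongr (BondConfig.relabel (sym2Equiv φ.toEquiv))
        (BondConfig.relabel (sym2Equiv φ.toEquiv)))) = Pc.prod (Pc.prod Pc) := by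
  have hΘ : Pc.map (BondConfig.relabel (sym2Equiv φ.toEquiv)) = Pc :=
    bondPercolation_map_relabel_iso φ (criticalProbI 3)
  have hm : Measurable (BondConfig.relabel (sym2Equiv φ.toEquiv)) :=
    (BondConfig.relabel (sym2Equiv φ.toEquiv)).measurable
  change (Pc.prod (Pc.prod Pc)).map (Prod.map (BondConfig.relabel (sym2Equiv φ.toEquiv))
    (Prod.map (BondConfig.relabel (sym2Equiv φ.toEquiv)) (BondConfig.relabel (sym2Equiv φ.toEquiv)))) = _
  rw [← Measure.map_prod_map _ _ hm (hm.prodMap hm), ← Measure.map_prod_map _ _ hm hm, hΘ]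

/-- **Two continuations**: `Qcc = Qbb`, where `Qcc = P⊗P⊗P{A_R, 0 ↔ c_r in hyb', 0 ↔ c_r in hyb''}`
(the diagonal action of `θ` on `P ⊗ P ⊗ P` maps one event onto the other, since `A_R` is
invariant and the hybrid is equivariant). [folklore] -/
theorem mirror_Qcc_eq_Qbb (r R : ℕ) :
    (Pc.prod (Pc.prod Pc)).real {x : BondConfig (Site 3) × (BondConfig (Site 3) × BondConfig (Site 3)) |
        x.1 ∈ AR r R ∧ hyb r R (x.1, x.2.1) ∈ openConn 0 (vC r) ∧
          hyb r R (x.1, x.2.2) ∈ openConn 0 (vC r)} = Qbb r R := by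
  have h0 := reflection_swap_zero
  have hA := mirror_swap_vA r
  have hbox := mirror_swap_mem_box_iff (R + r + 1)
  have hpre : (MeasurableEquiv.prodCongr
        (BondConfig.relabel (sym2Equiv (zdSignedPermIso (Equiv.swap (0 : Fin 3) 1) (fun _ => 1)).toEquiv))
        (MeasurableEquiv.prodCongr
          (BondConfig.relabel (sym2Equiv (zdSignedPermIso (Equiv.swap (0 : Fin 3) 1) (fun _ => 1)).toEquiv))
          (BondConfig.relabel
            (sym2Equiv (zdSignedPermIso (Equiv.swap (0 : Fin 3) 1) (fun _ => 1)).toEquiv)))) ⁻¹'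
      {x : BondConfig (Site 3) × (BondConfig (Site 3) × BondConfig (Site 3)) |
        x.1 ∈ AR r R ∧ hyb r R (x.1, x.2.1) ∈ openConn 0 (vB r) ∧
          hyb r R (x.1, x.2.2) ∈ openConn 0 (vB r)} =
      {x | x.1 ∈ AR r R ∧ hyb r R (x.1, x.2.1) ∈ openConn 0 (vC r) ∧
          hyb r R (x.1, x.2.2) ∈ openConn 0 (vC r)} := by
    ext x
    rw [Set.mem_preimage]
    simp only [Set.mem_setOf_eq]
    change BondConfig.relabel _ x.1 ∈ AR r R ∧
        hyb r R (BondConfig.relabel _ x.1, BondConfig.relabel _ x.2.1) ∈ openConn 0 (vB r) ∧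
        hyb r R (BondConfig.relabel _ x.1, BondConfig.relabel _ x.2.2) ∈ openConn 0 (vB r) ↔ _
    rw [mirror_mem_AR_relabel _ h0 hA, mirror_hyb_relabel _ h0 hA hbox, mirror_hyb_relabel _ h0 hA hbox,
      mirror_swap_mem_openConn_vB, mirror_swap_mem_openConn_vB]
  unfold Qbb
  rw [← hpre, measureReal_def, measureReal_def, ← MeasurableEquiv.map_apply, mirror_map_prod₃]

/-! ### Weighted Cauchy–Schwarz -/

/-- The algebra of the mirror Cauchy–Schwarz step: for weights `w ≥ 0` and two profiles `β, γ`
with `Σ w γ = Σ w β` and `Σ w γ² = Σ w β²`,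
`2 (Σ w β)² ≤ (Σ w) · (Σ w βγ + Σ w β²)` (Cauchy–Schwarz for `q = β + γ`). [folklore] -/
theorem mirror_weighted_cs {ι : Type*} (s : Finset ι) (w β γ : ι → ℝ) (hw : ∀ i ∈ s, 0 ≤ w i)
    (h1 : ∑ i ∈ s, w i * γ i = ∑ i ∈ s, w i * β i)
    (h2 : ∑ i ∈ s, w i * (γ i * γ i) = ∑ i ∈ s, w i * (β i * β i)) :
    2 * (∑ i ∈ s, w i * β i) ^ 2 ≤
      (∑ i ∈ s, w i) * (∑ i ∈ s, w i * (β i * γ i) + ∑ i ∈ s, w i * (β i * β i)) := by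
  have hq1 : ∑ i ∈ s, w i * (β i + γ i) = 2 * ∑ i ∈ s, w i * β i := by
    have : ∀ i, w i * (β i + γ i) = w i * β i + w i * γ i := fun i => by ring
    simp only [this, Finset.sum_add_distrib, h1]
    ring
  have hq2 : ∑ i ∈ s, w i * (β i + γ i) ^ 2 =
      2 * (∑ i ∈ s, w i * (β i * γ i) + ∑ i ∈ s, w i * (β i * β i)) := by
    have : ∀ i, w i * (β i + γ i) ^ 2 =
        w i * (β i * β i) + 2 * (w i * (β i * γ i)) + w i * (γ i * γ i) := fun i => by ring
    simp only [this, Finset.sum_add_distrib, ← Finset.mul_sum, h2]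
    ring
  have hcs := Finset.sum_sq_le_sum_mul_sum_of_sq_le_mul s (r := fun i => w i * (β i + γ i)) (f := w)
    (g := fun i => w i * (β i + γ i) ^ 2) hw (fun i hi => mul_nonneg (hw i hi) (sq_nonneg _))
    (fun i _ => le_of_eq (by ring))
  rw [hq1, hq2] at hcs
  nlinarith [hcs]

/-! ### The stub -/

open Classical in
/-- **Mirror Cauchy–Schwarz** (support stub `stub_mirrorCS` of the certificate line, the free
`v = 0` part of the vigour inequality): `2·Qb² ≤ P(A_R)·(Qbc + Qbb)`. With the launching
powers `m₊ = P'(0 ↔ b_r in hyb)`, `m₋ = P'(0 ↔ c_r in hyb)` of the certificate (functions of the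
explored data), `Qb = E[1_A m₊] = E[1_A m₋]`, `Qbb = E[1_A m₊²] = E[1_A m₋²]`, `Qbc = E[1_A m₊m₋]`
by the mirror symmetry `(x₀ x₁)`, so `Qbc + Qbb = ½ E[1_A (m₊+m₋)²]`, `2Qb = E[1_A (m₊+m₋)]`, and
Cauchy–Schwarz on `A_R` gives the claim. Formally: the data decomposition of
`…StrongMarkov.lean` turns all five quantities into finite weighted sums over the explored data,
the symmetry identities are `mirror_real_AR_inter_openConn` and `mirror_Qcc_eq_Qbb`, and the
inequality is the weighted Cauchy–Schwarz `mirror_weighted_cs`. [folklore] -/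
theorem stub_mirrorCS : ∀ r R : ℕ, 2 * Qb r R ^ 2 ≤ Pc.real (AR r R) * (Qbc r R + Qbb r R) := by
  intro r R
  obtain ⟨hstop, hNR⟩ := stub_stopping r R
  have hB : MeasurableSet (openConn 0 (vB r) : Set (BondConfig (Site 3))) :=
    measurableSet_openConn_holds 0 (vB r)
  have hC : MeasurableSet (openConn 0 (vC r) : Set (BondConfig (Site 3))) :=
    measurableSet_openConn_holds 0 (vC r)
  -- name the weights `w_d = P(piece_d ∩ A_R)` and the profiles `β_d, γ_d` (continuation
  -- probabilities of `{0 ↔ b_r}`, `{0 ↔ c_r}`), to keep the final algebra first-order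
  obtain ⟨w, hw⟩ : ∃ w : Finset (Sym2 (Site 3)) × Finset (Sym2 (Site 3)) → ℝ,
      ∀ d, Pc.real (dataPiece (explored r R) d.1 d.2 ∩ AR r R) = w d := ⟨_, fun _ => rfl⟩
  obtain ⟨β, hβ⟩ : ∃ β : Finset (Sym2 (Site 3)) × Finset (Sym2 (Site 3)) → ℝ,
      ∀ d, Pc.real ((fun ζ : BondConfig (Site 3) =>
        ((↑d.2 : Set (Sym2 (Site 3))) ∪ (ζ \ ↑d.1) : BondConfig (Site 3))) ⁻¹' openConn 0 (vB r)) = β d :=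
    ⟨_, fun _ => rfl⟩
  obtain ⟨γ, hγ⟩ : ∃ γ : Finset (Sym2 (Site 3)) × Finset (Sym2 (Site 3)) → ℝ,
      ∀ d, Pc.real ((fun ζ : BondConfig (Site 3) =>
        ((↑d.2 : Set (Sym2 (Site 3))) ∪ (ζ \ ↑d.1) : BondConfig (Site 3))) ⁻¹' openConn 0 (vC r)) = γ d :=
    ⟨_, fun _ => rfl⟩
  -- `P(A_R) = Σ w`
  have hAR : Pc.real (AR r R) =
      ∑ d ∈ ((edgeWindow r R).powerset ×ˢ (edgeWindow r R).powerset).filter (fun d => d.2 ⊆ d.1), w d := by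
    have h := markov_real_inter_eq_sum hstop hNR (E := Set.univ) MeasurableSet.univ
    rw [Set.inter_univ] at h
    rw [h]
    refine Finset.sum_congr rfl fun d _ => ?_
    rw [Set.preimage_univ, probReal_univ, mul_one, hw]
  -- `Σ w γ = Σ w β`: both are `P(A_R ∩ {0 ↔ ·})`, equal by the mirror
  have h1 : ∑ d ∈ ((edgeWindow r R).powerset ×ˢ (edgeWindow r R).powerset).filter (fun d => d.2 ⊆ d.1),
      w d * γ d =
      ∑ d ∈ ((edgeWindow r R).powerset ×ˢ (edgeWindow r R).powerset).filter (fun d => d.2 ⊆ d.1),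
        w d * β d := by
    have h := markov_real_inter_eq_sum hstop hNR hC
    rw [mirror_real_AR_inter_openConn r R, markov_real_inter_eq_sum hstop hNR hB] at h
    simp only [hw, hβ, hγ] at h
    exact h.symm
  -- `Σ w γ² = Σ w β²`: `Qcc = Qbb` by the mirror
  have h2 : ∑ d ∈ ((edgeWindow r R).powerset ×ˢ (edgeWindow r R).powerset).filter (fun d => d.2 ⊆ d.1),
      w d * (γ d * γ d) =
      ∑ d ∈ ((edgeWindow r R).powerset ×ˢ (edgeWindow r R).powerset).filter (fun d => d.2 ⊆ d.1),
        w d * (β d * β d) := by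
    have h := markov_prod₃_real_eq_sum hstop hNR hC hC
    rw [mirror_Qcc_eq_Qbb r R] at h
    unfold Qbb at h
    rw [markov_prod₃_real_eq_sum hstop hNR hB hB] at h
    simp only [hw, hβ, hγ] at h
    exact h.symm
  unfold Qb Qbc Qbb
  rw [markov_prod_real_eq_sum hstop hNR hB, markov_prod₃_real_eq_sum hstop hNR hB hC,
    markov_prod₃_real_eq_sum hstop hNR hB hB, hAR]
  simp only [hw, hβ, hγ]
  exact mirror_weighted_cs _ w β γ (fun d _ => (hw d) ▸ measureReal_nonneg) h1 h2

end Summit.CriticalPhenomena.PercolationContinuityZ3.Theorems.TetrahedronLogConvexity.Cert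

end
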